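import Literature.AnabelianGeometry.EtaleTheta.Discharge.Sec4GaloisSurjNaturalModel
import Literature.AnabelianGeometry.EtaleTheta.Discharge.Sec5OfTemperoidThetaDivisor
import Literature.AlgebraicGeometry.Frobenioids.QuasiTemperoidConnectedPart
import Literature.AlgebraicGeometry.Frobenioids.ModelFrobenioidDivision
import Literature.AnabelianGeometry.EtaleTheta.Discharge.Sec3Thm37Holds

/-!
# [EtTh] §5 data over the GENUINE CONNECTED base `D := B^temp(Π^tp_X)⁰` (Def. 3.6 (ii) p.302, Def. 4.1 p.312–313, §5 pp.330–331 / PDF pp.76, 86–87, 104–105)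

Mochizuki, *The étale theta function …*, Publ. RIMS **45** (2009)
[cite: MochizukiEtTh2009, Def 3.6 p.302 (PDF p.76); Def 4.1 (ii) p.313 (PDF p.87); §5 p.330–331 (PDF pp.104–105)].  Seat abc-iut-L2-t4
(§5 owner), ROW W3-L2-01 «§5 GENUINE DATA» — RE-BASE of `Discharge/Sec5OfTemperoidModelData.lean` (p423781),
`Discharge/Sec5OfTemperoidThetaDivisor.lean` (p425643) after abc-iut-w4-d099's finding F-w4d099-1
(`Discharge/Sec3TemperedFrobenioidBTempVacuity.lean`, p425482): Def. 3.6 (ii) requires `D` "connected, totally epimorphic", which the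
FULL temperoid `B^temp(Π)` is not (`TemperedFrobenioid.isEmpty_of_bTemp`) — so every declaration over `BTemp X.Pi` there is
vacuously parametrised.  The genuine base of §3–§5 is print's superscript-`0` category `B^temp(Π^tp_X)⁰ = ConnectedPart (BTemp X.Pi)`
(connected and totally epimorphic: `QuasiTemperoid.BTempConnected.connectedPart_isConnected` / `connectedPart_isTotallyEpimorphic`,
[FrdII] Ex. 1.3).  Everything is redone here over that base; additive, no landed declaration touched:
* `BiKummerSetting.mkOfConnectedTemperoid` — abc-iut-L2-t9's `mkOfModelCanonical` over `B^temp(Π^tp_X)⁰` with the Galois objects of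
  [SemiAnbd] Def. 3.1 (iv) on the underlying `Π^tp_X`-set and the Galois surjections `galoisSurjOf` ([SemiAnbd] Rmk. 3.1.3,
  abc-iut-w5-d013) transported to the full subcategory along `Aut A ≃* Aut A.obj` (the composite spelled out by abc-iut-w4-d099,
  INBOX 05:47:48Z); laws `mkOfConnectedTemperoid_galoisSurj_natural` (binder `hS` — THEOREM), `…_isOpen_ker_galoisSurj` (`hopen` —
  THEOREM), `mem_Hodot_mkOfConnectedTemperoid_iff` (`H_⊙` = stabiliser of every point of `A_⊙^bs`);
* `ThetaFrobenioid.ofConnectedTemperoidData` — the §5 data over it: `hopen` discharged, `σ = s^trv_N := strvOfBiKummerData`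
  constructed, `hdivc`/`hdivp` from the divisor invariances `hinvc`/`hinvp`; dictionary; Spec/Section/Aut-ampleness theorems;
  `biratAutAction_…`; `facts_ofConnectedTemperoidData` ⟸ {`hH`, `hconst`, `hgc`}; and `hinvc_ofConnectedTemperoid` /
  `hinvp_ofConnectedTemperoid` — the divisor inputs from the `Π^tp_X`-stability `hθ`, `hθ'` of `Div(s')`, `Div(s'')` of the
  fraction-pair of `Θ̈` (Prop. 4.3 (i) proof p.317; §5 p.330);
* the CANONICAL `A_⊙ := (Π^tp_X/M, 0) ∈ Ob(C)` over the connected Galois object `Π^tp_X/M ∈ B^temp(Π^tp_X)⁰`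
  (`TemperedFrobenioid.connQuotZeroObj`; [FrdI] Thm. 5.2: "`α = 0` objects are Frobenius-trivial"), `mkOfConnectedTemperoidQuot`
  with `Hodot_mkOfConnectedTemperoidQuot : H_⊙ = M`, and the §5 choice `M := ιX(Π^tp_Ÿ)` — **`A_⊙^bs := Ÿ`** —
  `mkOfConnectedTemperoidYdd T ιX` with **`hH_mkOfConnectedTemperoidYdd`**: the binder `hH` (`Π^tp_Ÿ ⊆ H_⊙`) is a THEOREM;
  `facts_ofConnectedTemperoidYddData` ⟸ {`hconst`, `hgc`}.
INPUTS of the §5 data over `B^temp(Π^tp_X)⁰` after this file: `h` ([FrdI] Thm. 5.2 hypotheses), `Q`, the roots, `ιX`, the constants,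
`hθ`/`hθ'` (Prop. 1.4), `hconst` (Def. 3.6 (iii)), `hgc` (Lemma 5.8); the `(N,H)`-saturation predicate `NH` stays a parameter.
HONEST FRAMING: constructions and kernel-checked implications over abc-iut-L2-t3's / abc-iut-L3's data structures; the parameter
class `TemperedFrobenioid T₀ (ConnectedPart (BTemp X.Pi)) VD` is NOT shown inhabited here (its two category axioms are theorems;
the divisor data are abc-iut-L2-t10's at the junction); no side taken on anything downstream.
-/

noncomputable section

namespace Literature.AnabelianGeometry.EtaleTheta

open CategoryTheory Opposite Literature.AlgebraicGeometry.Frobenioids Literature.AnabelianGeometry.SemiGraphs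
  Literature.AnabelianGeometry.SemiGraphs.GaloisObjects Literature.AlgebraicGeometry.Frobenioids.QuasiTemperoid.BTempConnected

universe u₀ v₀ w

/-! ## The Frobenius-trivial object `(Π^tp_X/M, 0)` over the connected Galois object `Π^tp_X/M` -/

namespace TemperedFrobenioid

variable {K : Type u₀} [Field K] {X : SemiGraphs.TemperedArithmeticGroup.{u₀} K} {D₀ : Type u₀} [Category.{v₀} D₀]
  {V : FrdIMonoidStub.{w}} {T₀ : RealifiedDivisorMonoids (D₀ := D₀) V}
  {VD : FrdICatStub.{u₀ + 1, u₀, w} (ConnectedPart (BTemp X.Pi))}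
  (tf : TemperedFrobenioid T₀ (ConnectedPart (BTemp X.Pi)) VD) (M : OpenNormalSubgroup X.Pi)

/-- `Π^tp_X/M` as an object of the connected part `B^temp(Π^tp_X)⁰` ([SemiAnbd] Rmk. 3.1.2: `Π/M` is connected).
[cite: MochizukiSemiAnbd2006, Rmk 3.1.2 p.33] -/
def connQuotObj : ConnectedPart (BTemp X.Pi) :=
  ⟨BTemp.quotientObj X.Pi X.isTempered M.toSubgroup M.isOpen', isConnectedObj_quotientObj X.isTempered _ _⟩

/-- **`(Π^tp_X/M, 0)`**: the object of the tempered Frobenioid over `B^temp(Π^tp_X)⁰` with base `Π^tp_X/M` and trivial class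
([FrdI] Thm. 5.2 (i)).  [cite: MochizukiEtTh2009, Def 4.1 p.312 (PDF p.86)] -/
def connQuotZeroObj : tf.category :=
  ModelFrobenioid.zeroObj tf.divisorMonoid tf.ratFnFunctor tf.divBNatTrans (connQuotObj (X := X) M)

/-- The base of `(Π^tp_X/M, 0)` (definitionally). [cite: MochizukiEtTh2009, Def 4.1 p.312 (PDF p.86)] -/
theorem connQuotZeroObj_base : (tf.connQuotZeroObj M).base = connQuotObj (X := X) M := rfl

/-- **`(Π^tp_X/M, 0)` is Frobenius-trivial** ([FrdI] Thm. 5.2, p.101; `B` group-like by `ratFnFunctor_isGroupLike_holds`).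
[cite: MochizukiFrdI2008, Thm. 5.2 p.101] -/
theorem isFrobeniusTrivial_connQuotZeroObj : PreFrobenioid.IsFrobeniusTrivial tf.toElem (tf.connQuotZeroObj M) :=
  ModelFrobenioid.isFrobeniusTrivial_zeroObj tf.ratFnFunctor_isGroupLike_holds _

/-- The underlying `Π^tp_X`-set of the base of `(Π^tp_X/M, 0)` is a Galois object ([SemiAnbd] Rmk. 3.1.3).
[cite: MochizukiSemiAnbd2006, Rmk 3.1.3 p.34] -/
theorem isGaloisObj_connQuotZeroObj_base : SemiGraphs.IsGaloisObj (tf.connQuotZeroObj M).base.obj :=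
  isGaloisObj_of_iso_quotientObj X.isTempered _ M (Iso.refl _)

end TemperedFrobenioid

/-! ## The §4 setting over `B^temp(Π^tp_X)⁰` -/

namespace BiKummerSetting

variable {K : Type u₀} [Field K] (X : SemiGraphs.TemperedArithmeticGroup.{u₀} K) {D₀ : Type u₀} [Category.{v₀} D₀]
  {V : FrdIMonoidStub.{w}} {T₀ : RealifiedDivisorMonoids (D₀ := D₀) V}
  {VD : FrdICatStub.{u₀ + 1, u₀, w} (ConnectedPart (BTemp X.Pi))}
  (tf : TemperedFrobenioid T₀ (ConnectedPart (BTemp X.Pi)) VD) (hZ : tf.monoidType = MonoidType.Z)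
  (hP : ∀ A : (ConnectedPart (BTemp X.Pi))ᵒᵖ, IsPerfect (tf.Φ.carrier A))
  (NH : Subgroup (Field.absoluteGaloisGroup K) → tf.category → ℕ+ → Prop)

section Setting

variable (A₀ : tf.category) (hA₀ : PreFrobenioid.IsFrobeniusTrivial tf.toElem A₀) (hA₀' : SemiGraphs.IsGaloisObj A₀.base.obj)

/-- **The §4 bi-Kummer setting over the GENUINE connected base `D := B^temp(Π^tp_X)⁰`** (Def. 4.1, pp.312–313 (PDF pp.86–87);
Def. 3.6 (ii): `D` connected, totally epimorphic): abc-iut-L2-t9's `mkOfModelCanonical` with Galois objects := those whose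
underlying `Π^tp_X`-set is Galois ([SemiAnbd] Def. 3.1 (iv)) and Galois surjections := `galoisSurjOf` ([SemiAnbd] Rmk. 3.1.3)
transported along `Aut A ≃* Aut A.obj` (full subcategory).  [cite: MochizukiEtTh2009, Def 4.1 p.313 (PDF p.87)] -/
def mkOfConnectedTemperoid : BiKummerSetting X T₀ (ConnectedPart (BTemp X.Pi)) VD :=
  mkOfModelCanonical X tf hZ hP (fun A => SemiGraphs.IsGaloisObj A.obj)
    (fun A h => ((connectedObjects (BTemp X.Pi)).fullyFaithfulι.autMulEquivOfFullyFaithful A).symm.toMonoidHom.comp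
      (galoisSurjOf X.isTempered A.obj h))
    (fun A h => by
      rw [MonoidHom.coe_comp]
      exact (MulEquiv.surjective _).comp (galoisSurjOf_surjective X.isTempered A.obj h))
    NH A₀ hA₀ hA₀'

/-- The underlying tempered Frobenioid is `tf` (definitionally). [cite: MochizukiEtTh2009, Def 4.1 p.312 (PDF p.86)] -/
theorem mkOfConnectedTemperoid_tf : (mkOfConnectedTemperoid X tf hZ hP NH A₀ hA₀ hA₀').tf = tf := rfl

/-- On underlying `Π^tp_X`-sets the Galois surjection of the setting IS `galoisSurjOf` (definitionally).
[cite: MochizukiEtTh2009, Def 4.1 (ii) p.313 (PDF p.87)] -/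
theorem mkOfConnectedTemperoid_galoisSurj_hom_hom (A : ConnectedPart (BTemp X.Pi))
    (hA : (mkOfConnectedTemperoid X tf hZ hP NH A₀ hA₀ hA₀').IsGaloisObj A) (g : X.Pi) :
    ((mkOfConnectedTemperoid X tf hZ hP NH A₀ hA₀ hA₀').galoisSurj A hA g).hom.hom = (galoisSurjOf X.isTempered A.obj hA g).hom :=
  rfl

/-- The kernel of the setting's Galois surjection is that of `galoisSurjOf` (the transport is injective).
[cite: MochizukiEtTh2009, Def 4.1 (ii) p.313 (PDF p.87)] -/
theorem ker_mkOfConnectedTemperoid_galoisSurj (A : ConnectedPart (BTemp X.Pi))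
    (hA : (mkOfConnectedTemperoid X tf hZ hP NH A₀ hA₀ hA₀').IsGaloisObj A) :
    ((mkOfConnectedTemperoid X tf hZ hP NH A₀ hA₀ hA₀').galoisSurj A hA).ker = (galoisSurjOf X.isTempered A.obj hA).ker := by
  ext g
  rw [MonoidHom.mem_ker, MonoidHom.mem_ker]
  change ((connectedObjects (BTemp X.Pi)).fullyFaithfulι.autMulEquivOfFullyFaithful A).symm
      (galoisSurjOf X.isTempered A.obj hA g) = 1 ↔ _
  rw [MulEquiv.map_eq_one_iff]
  exact Iff.rfl

/-- **Def. 4.1 (ii) naturality ("natural surjective outer homomorphism") is a THEOREM over `B^temp(Π^tp_X)⁰`** — the binder `hS`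
of `Discharge/Sec4GaloisSurjNatural.lean` holds: abc-iut-w5-d013's `galoisSurjOf_natural` read in the full subcategory.
[cite: MochizukiEtTh2009, Def 4.1 (ii) p.313 (PDF p.87)] -/
theorem mkOfConnectedTemperoid_galoisSurj_natural :
    ∀ ⦃A B : ConnectedPart (BTemp X.Pi)⦄ (hA : (mkOfConnectedTemperoid X tf hZ hP NH A₀ hA₀ hA₀').IsGaloisObj A)
      (hB : (mkOfConnectedTemperoid X tf hZ hP NH A₀ hA₀ hA₀').IsGaloisObj B) (b : B ⟶ A), ∃ c : X.Pi, ∀ g : X.Pi,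
        ((mkOfConnectedTemperoid X tf hZ hP NH A₀ hA₀ hA₀').galoisSurj B hB g).hom ≫ b =
          b ≫ ((mkOfConnectedTemperoid X tf hZ hP NH A₀ hA₀ hA₀').galoisSurj A hA (c * g * c⁻¹)).hom := by
  intro A B hA hB b
  obtain ⟨c, hc⟩ := galoisSurjOf_natural X.isTempered hA hB b.hom
  refine ⟨c, fun g => ?_⟩
  apply InducedCategory.hom_ext
  change (galoisSurjOf X.isTempered B.obj hB g).hom ≫ b.hom = b.hom ≫ (galoisSurjOf X.isTempered A.obj hA (c * g * c⁻¹)).hom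
  exact hc g

/-- **The kernel of `Π^tp_X ↠ Aut(A)` is OPEN over `B^temp(Π^tp_X)⁰`** — the §5 binder `hopen` is a theorem here.
[cite: MochizukiEtTh2009, Def 4.1 (ii) p.313 (PDF p.87)] -/
theorem mkOfConnectedTemperoid_isOpen_ker_galoisSurj (A : ConnectedPart (BTemp X.Pi))
    (hA : (mkOfConnectedTemperoid X tf hZ hP NH A₀ hA₀ hA₀').IsGaloisObj A) :
    IsOpen (((mkOfConnectedTemperoid X tf hZ hP NH A₀ hA₀ hA₀').galoisSurj A hA).ker : Set X.Pi) := by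
  rw [ker_mkOfConnectedTemperoid_galoisSurj]
  exact isOpen_ker_galoisSurjOf X.isTempered A.obj hA

/-- **`H_⊙` is the stabiliser of every point of `A_⊙^bs`** over `B^temp(Π^tp_X)⁰` (p.312 (PDF p.86): "the open subgroup determined
by `A_⊙`").  [cite: MochizukiEtTh2009, Def 4.1 p.312 (PDF p.86)] -/
theorem mem_Hodot_mkOfConnectedTemperoid_iff (x : A₀.base.obj.obj.V) (g : X.Pi) :
    g ∈ (mkOfConnectedTemperoid X tf hZ hP NH A₀ hA₀ hA₀').Hodot ↔ A₀.base.obj.obj.ρ g x = x := by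
  change g ∈ ((mkOfConnectedTemperoid X tf hZ hP NH A₀ hA₀ hA₀').galoisSurj A₀.base hA₀').ker ↔ _
  rw [ker_mkOfConnectedTemperoid_galoisSurj]
  exact mem_ker_galoisSurjOf_iff_apply X.isTempered A₀.base.obj hA₀' x g

/-- `H_⊙` is open over `B^temp(Π^tp_X)⁰` (abc-iut-L2-t3's `Thm44Hyp.isOpen_Hodot` discharged). [cite: MochizukiEtTh2009, Def 4.1 p.312 (PDF p.86)] -/
theorem isOpen_Hodot_mkOfConnectedTemperoid : IsOpen ((mkOfConnectedTemperoid X tf hZ hP NH A₀ hA₀ hA₀').Hodot : Set X.Pi) :=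
  mkOfConnectedTemperoid_isOpen_ker_galoisSurj X tf hZ hP NH A₀ hA₀ hA₀' A₀.base hA₀'

/-- The §5 binder `hH` over `B^temp(Π^tp_X)⁰` holds as soon as `Π^tp_Ÿ` fixes a point of `A_⊙^bs`.
[cite: MochizukiEtTh2009, §5 p.330 (PDF p.104)] -/
theorem hH_mkOfConnectedTemperoid_of_fixes {P : Type*} [Group P] [TopologicalSpace P] (ιX : P ≃ₜ* X.Pi) (PiYdd : Subgroup P)
    (x : A₀.base.obj.obj.V) (hfix : ∀ y : P, y ∈ PiYdd → A₀.base.obj.obj.ρ (ιX y) x = x) :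
    ∀ y : P, y ∈ PiYdd → ιX y ∈ (mkOfConnectedTemperoid X tf hZ hP NH A₀ hA₀ hA₀').Hodot :=
  fun y hy => (mem_Hodot_mkOfConnectedTemperoid_iff X tf hZ hP NH A₀ hA₀ hA₀' x (ιX y)).2 (hfix y hy)

end Setting

/-! ## The canonical `A_⊙ := (Π^tp_X/M, 0)`; the §5 choice `M := ιX(Π^tp_Ÿ)` (`A_⊙^bs := Ÿ`) -/

section Quot

variable (M : OpenNormalSubgroup X.Pi)

/-- **The setting over `B^temp(Π^tp_X)⁰` with `A_⊙ := (Π^tp_X/M, 0)`.** [cite: MochizukiEtTh2009, Def 4.1 p.312 (PDF p.86)] -/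
def mkOfConnectedTemperoidQuot : BiKummerSetting X T₀ (ConnectedPart (BTemp X.Pi)) VD :=
  mkOfConnectedTemperoid X tf hZ hP NH (tf.connQuotZeroObj M) (tf.isFrobeniusTrivial_connQuotZeroObj M)
    (tf.isGaloisObj_connQuotZeroObj_base M)

/-- **`H_⊙ = M`** for `A_⊙ := (Π^tp_X/M, 0)` (membership). [cite: MochizukiEtTh2009, Def 4.1 p.312 (PDF p.86)] -/
theorem mem_Hodot_mkOfConnectedTemperoidQuot_iff (g : X.Pi) :
    g ∈ (mkOfConnectedTemperoidQuot X tf hZ hP NH M).Hodot ↔ g ∈ M := by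
  rw [mkOfConnectedTemperoidQuot, mem_Hodot_mkOfConnectedTemperoid_iff X tf hZ hP NH (tf.connQuotZeroObj M)
    (tf.isFrobeniusTrivial_connQuotZeroObj M) (tf.isGaloisObj_connQuotZeroObj_base M) ((1 : X.Pi) : X.Pi ⧸ M.toSubgroup) g]
  exact quotientObj_ρ_one_eq_iff X.isTempered M.toSubgroup M.isOpen' g

/-- **`H_⊙ = M`** for `A_⊙ := (Π^tp_X/M, 0)`. [cite: MochizukiEtTh2009, Def 4.1 p.312 (PDF p.86)] -/
theorem Hodot_mkOfConnectedTemperoidQuot : (mkOfConnectedTemperoidQuot X tf hZ hP NH M).Hodot = M.toSubgroup :=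
  Subgroup.ext (mem_Hodot_mkOfConnectedTemperoidQuot_iff X tf hZ hP NH M)

end Quot

section Ydd

variable {N : ℕ+} (T : ThetaEnvData.{max u₀ w} N) (ιX : T.PiX ≃ₜ* X.Pi)

/-- **The §5 setting over `B^temp(Π^tp_X)⁰` with `A_⊙^bs := Ÿ`**: `A_⊙ := (Π^tp_X/ιX(Π^tp_Ÿ), 0)`, `Π^tp_Ÿ = T.PiYdd`
(`yddSubgroup` of `Discharge/Sec5OfTemperoidYdd`-style: the open normal image subgroup).  [cite: MochizukiEtTh2009, §5 p.330 (PDF p.104)] -/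
def mkOfConnectedTemperoidYdd : BiKummerSetting X T₀ (ConnectedPart (BTemp X.Pi)) VD :=
  haveI := T.PiYdd_normal
  mkOfConnectedTemperoidQuot X tf hZ hP NH
    { toSubgroup := T.PiYdd.map ιX.toMonoidHom
      isOpen' := by
        change IsOpen ((T.PiYdd.map ιX.toMonoidHom : Subgroup X.Pi) : Set X.Pi)
        rw [Subgroup.coe_map]
        exact ιX.isOpenMap _ T.PiYdd_open
      isNormal' := T.PiYdd_normal.map ιX.toMonoidHom ιX.surjective }

/-- **`H_⊙ = ιX(Π^tp_Ÿ)`** for the §5 choice (membership). [cite: MochizukiEtTh2009, §5 p.330 (PDF p.104)] -/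
theorem mem_Hodot_mkOfConnectedTemperoidYdd_iff (g : X.Pi) :
    g ∈ (mkOfConnectedTemperoidYdd X tf hZ hP NH T ιX).Hodot ↔ ιX.symm g ∈ T.PiYdd := by
  rw [mkOfConnectedTemperoidYdd, mem_Hodot_mkOfConnectedTemperoidQuot_iff]
  change g ∈ T.PiYdd.map ιX.toMonoidHom ↔ _
  constructor
  · rintro ⟨y, hy, rfl⟩
    change ιX.symm (ιX y) ∈ T.PiYdd
    rwa [ιX.symm_apply_apply]
  · intro h
    exact ⟨ιX.symm g, h, ιX.apply_symm_apply g⟩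

/-- **The §5 binder `hH` (`Π^tp_Ÿ ⊆ H_⊙`) is a THEOREM for `A_⊙^bs := Ÿ` over `B^temp(Π^tp_X)⁰`.** [cite: MochizukiEtTh2009, §5 p.330 (PDF p.104)] -/
theorem hH_mkOfConnectedTemperoidYdd :
    ∀ y : T.PiX, y ∈ T.PiYdd → ιX y ∈ (mkOfConnectedTemperoidYdd X tf hZ hP NH T ιX).Hodot := by
  intro y hy
  rw [mem_Hodot_mkOfConnectedTemperoidYdd_iff]
  rwa [ιX.symm_apply_apply]

end Ydd

end BiKummerSetting

/-! ## The §5 data over `B^temp(Π^tp_X)⁰` -/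

namespace ThetaFrobenioid

variable {K : Type u₀} [Field K] {X : SemiGraphs.TemperedArithmeticGroup.{u₀} K} {D₀ : Type u₀} [Category.{v₀} D₀]
  {V : FrdIMonoidStub.{w}} {T₀ : RealifiedDivisorMonoids (D₀ := D₀) V}
  {VD : FrdICatStub.{u₀ + 1, u₀, w} (ConnectedPart (BTemp X.Pi))}
  {tf : TemperedFrobenioid T₀ (ConnectedPart (BTemp X.Pi)) VD} {hZ : tf.monoidType = MonoidType.Z}
  {hP : ∀ A : (ConnectedPart (BTemp X.Pi))ᵒᵖ, IsPerfect (tf.Φ.carrier A)}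
  {NH : Subgroup (Field.absoluteGaloisGroup K) → tf.category → ℕ+ → Prop} {A₀ : tf.category}
  {hA₀ : PreFrobenioid.IsFrobeniusTrivial tf.toElem A₀} {hA₀' : SemiGraphs.IsGaloisObj A₀.base.obj}
  {pullFrac : ∀ {A A' : (BiKummerSetting.mkOfConnectedTemperoid X tf hZ hP NH A₀ hA₀ hA₀').C} (_ : A' ⟶ A),
    (BiKummerSetting.mkOfConnectedTemperoid X tf hZ hP NH A₀ hA₀ hA₀').biratUnits A →
      (BiKummerSetting.mkOfConnectedTemperoid X tf hZ hP NH A₀ hA₀ hA₀').biratUnits A'}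
  {lv N : ℕ+} {T : ThetaEnvData.{max u₀ w} N}
  {θ : (BiKummerSetting.mkOfConnectedTemperoid X tf hZ hP NH A₀ hA₀ hA₀').biratUnits
    (BiKummerSetting.mkOfConnectedTemperoid X tf hZ hP NH A₀ hA₀ hA₀').Aodot}
  {Bl : (BiKummerSetting.mkOfConnectedTemperoid X tf hZ hP NH A₀ hA₀ hA₀').C}
  {Pl : (BiKummerSetting.mkOfConnectedTemperoid X tf hZ hP NH A₀ hA₀ hA₀').FractionPair θ Bl}
  {Rl : (BiKummerSetting.mkOfConnectedTemperoid X tf hZ hP NH A₀ hA₀ hA₀').NthRoot θ Pl lv pullFrac}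
  (h : ModelFrobenioid.Hypotheses tf.divisorMonoid tf.ratFnFunctor)
  (Q : FrobenioidTheta.ThetaSubquotientStub.{w} (ConnectedPart (BTemp X.Pi))) (odd_l : Odd (lv : ℕ))
  (R : (BiKummerSetting.mkOfConnectedTemperoid X tf hZ hP NH A₀ hA₀ hA₀').NthRoot Rl.root Rl.pair N pullFrac)
  (ιX : T.PiX ≃ₜ* X.Pi) (K' : Type w) [Field K'] (constEmb : K'ˣ →* tf.biratUnitsModel R.BN)
  (constEmb_injective : Function.Injective constEmb)
  (hinvc : ∀ g : Aut R.AN.base,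
    pull tf.divisorMonoid g.hom (ModelFrobenioid.div R.pair.num) = ModelFrobenioid.div R.pair.num)
  (hinvp : ∀ y : T.PiX, y ∈ T.PiYdd →
    pull tf.divisorMonoid ((BiKummerSetting.mkOfConnectedTemperoid X tf hZ hP NH A₀ hA₀ hA₀').galoisSurj R.AN.base
      R.αData.isGalois (ιX y)).hom (ModelFrobenioid.div R.pair.den) = ModelFrobenioid.div R.pair.den)

/-- **The [EtTh] §5 data over the GENUINE connected base `B^temp(Π^tp_X)⁰`** (§5, pp.330–331 (PDF pp.104–105)): `ofBiKummerData`
over `mkOfConnectedTemperoid` (dictionary = identity) with `hopen` DISCHARGED, `σ = s^trv_N := strvOfBiKummerData` CONSTRUCTED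
([FrdI] Prop. 5.6 section of the Frobenius-trivial `A_N`), `hdivc`/`hdivp` from the divisor invariances `hinvc` (p.330) / `hinvp`
(Prop. 4.3 (i) proof, p.317) via `hdivc_of_pull_invariant` / `hdivp_of_pull_invariant` (`Φ` divisorial by `h`).
[cite: MochizukiEtTh2009, §5 p.330–331 (PDF pp.104–105)] -/
def ofConnectedTemperoidData :
    ThetaFrobenioid.{w} (BiKummerSetting.mkOfConnectedTemperoid X tf hZ hP NH A₀ hA₀ hA₀').C (ConnectedPart (BTemp X.Pi)) :=
  ofBiKummerData h (fun _ => MonoidHom.id _) Q odd_l R ιX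
    (BiKummerSetting.mkOfConnectedTemperoid_isOpen_ker_galoisSurj X tf hZ hP NH A₀ hA₀ hA₀' R.AN.base R.αData.isGalois)
    (strvOfBiKummerData h R) K' constEmb constEmb_injective
    (hdivc_of_pull_invariant h.isDivisorial R (strvOfBiKummerData h R) (baseMap_strvOfBiKummerData h R) hinvc)
    (hdivp_of_pull_invariant h.isDivisorial R ιX (strvOfBiKummerData h R) (baseMap_strvOfBiKummerData h R) hinvp)

/-- `ofConnectedTemperoidData` unfolds to `ofBiKummerData` with the discharged arguments (definitionally) — the rfl dictionary and
every theorem of `FrobenioidThetaOfBiKummerData.lean` / `Discharge/Sec5OfModelData.lean` apply verbatim.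
[cite: MochizukiEtTh2009, §5 p.330–331 (PDF pp.104–105)] -/
theorem ofConnectedTemperoidData_eq :
    ofConnectedTemperoidData h Q odd_l R ιX K' constEmb constEmb_injective hinvc hinvp =
      ofBiKummerData h (fun _ => MonoidHom.id _) Q odd_l R ιX
        (BiKummerSetting.mkOfConnectedTemperoid_isOpen_ker_galoisSurj X tf hZ hP NH A₀ hA₀ hA₀' R.AN.base R.αData.isGalois)
        (strvOfBiKummerData h R) K' constEmb constEmb_injective
        (hdivc_of_pull_invariant h.isDivisorial R (strvOfBiKummerData h R) (baseMap_strvOfBiKummerData h R) hinvc)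
        (hdivp_of_pull_invariant h.isDivisorial R ιX (strvOfBiKummerData h R) (baseMap_strvOfBiKummerData h R)
          hinvp) := rfl

/-- `s^trv_N` of the data is the constructed section. [cite: MochizukiEtTh2009, §5 p.331 (PDF p.105)] -/
theorem ofConnectedTemperoidData_strv :
    (ofConnectedTemperoidData h Q odd_l R ιX K' constEmb constEmb_injective hinvc hinvp).strv = strvOfBiKummerData h R := rfl

/-- **`StrvSection` is UNCONDITIONAL** (`σ` constructed). [cite: MochizukiEtTh2009, §5 p.331 (PDF p.105)] -/
theorem strvSection_ofConnectedTemperoidData :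
    (ofConnectedTemperoidData h Q odd_l R ιX K' constEmb constEmb_injective hinvc hinvp).StrvSection :=
  strvSection_ofBiKummerData h _ Q odd_l R ιX _ _ K' constEmb constEmb_injective _ _ (baseMap_strvOfBiKummerData h R)

/-- `SgpCapSpec`. [cite: MochizukiEtTh2009, §5 p.331 (PDF p.105)] -/
theorem sgpCapSpec_ofConnectedTemperoidData :
    (ofConnectedTemperoidData h Q odd_l R ιX K' constEmb constEmb_injective hinvc hinvp).SgpCapSpec :=
  sgpCapSpec_ofBiKummerData h _ Q odd_l R ιX _ _ K' constEmb constEmb_injective _ _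

/-- `SgpCupSpec`. [cite: MochizukiEtTh2009, §5 p.331 (PDF p.105)] -/
theorem sgpCupSpec_ofConnectedTemperoidData :
    (ofConnectedTemperoidData h Q odd_l R ιX K' constEmb constEmb_injective hinvc hinvp).SgpCupSpec :=
  sgpCupSpec_ofBiKummerData h _ Q odd_l R ιX _ _ K' constEmb constEmb_injective _ _

/-- `SgpCapSection`. [cite: MochizukiEtTh2009, §5 p.331 (PDF p.105)] -/
theorem sgpCapSection_ofConnectedTemperoidData :
    (ofConnectedTemperoidData h Q odd_l R ιX K' constEmb constEmb_injective hinvc hinvp).SgpCapSection :=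
  sgpCapSection_ofBiKummerData h _ Q odd_l R ιX _ _ K' constEmb constEmb_injective _ _ (baseMap_strvOfBiKummerData h R)

/-- `AutAmpleBN` ("it follows that `B_N` is Aut-ample", p.330 (PDF p.104)). [cite: MochizukiEtTh2009, §5 p.330 (PDF p.104)] -/
theorem autAmpleBN_ofConnectedTemperoidData :
    (ofConnectedTemperoidData h Q odd_l R ιX K' constEmb constEmb_injective hinvc hinvp).AutAmpleBN :=
  autAmpleBN_ofBiKummerData h _ Q odd_l R ιX _ _ K' constEmb constEmb_injective _ _ (baseMap_strvOfBiKummerData h R)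

/-- **The natural action on `O^×(B_N^birat)`** (abc-iut-L2-t11's `BiratAutAction` via abc-iut-L2-t9's `biratAutModel`; input `hconst`,
Def. 3.6 (iii)).  [cite: MochizukiEtTh2009, Def 3.6 (iii) p.304 (PDF p.78); Lem 5.8 p.331 (PDF p.105)] -/
def biratAutAction_ofConnectedTemperoidData
    (hconst : ∀ (e : Aut R.BN) (k : K'ˣ), tf.biratAutModel R.BN e (constEmb k) = constEmb k) :
    (ofConnectedTemperoidData h Q odd_l R ιX K' constEmb constEmb_injective hinvc hinvp).BiratAutAction :=
  biratAutAction_ofModelData h Q odd_l R ιX _ _ K' constEmb constEmb_injective _ _ hconst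

/-- **`Facts` for the §5 data over `B^temp(Π^tp_X)⁰` from `hH` (`Π^tp_Ÿ ⊆ H_⊙`), `hconst` (Def. 3.6 (iii)) and `hgc` (Lemma 5.8's
geometric connectedness)** — every other §5 named input a THEOREM.  [cite: MochizukiEtTh2009, §5 p.330–331 (PDF pp.104–105); Lem 5.8 p.331 (PDF p.105)] -/
theorem facts_ofConnectedTemperoidData
    (hH : ∀ y : T.PiX, y ∈ T.PiYdd → ιX y ∈ (BiKummerSetting.mkOfConnectedTemperoid X tf hZ hP NH A₀ hA₀ hA₀').Hodot)
    (hconst : ∀ (e : Aut R.BN) (k : K'ˣ), tf.biratAutModel R.BN e (constEmb k) = constEmb k)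
    (hgc : ∀ u : (ofConnectedTemperoidData h Q odd_l R ιX K' constEmb constEmb_injective hinvc hinvp).units
        (ofConnectedTemperoidData h Q odd_l R ιX K' constEmb constEmb_injective hinvc hinvp).BN,
      (∀ y ∈ (ofConnectedTemperoidData h Q odd_l R ιX K' constEmb constEmb_injective hinvc hinvp).imPiY,
        (ofConnectedTemperoidData h Q odd_l R ιX K' constEmb constEmb_injective hinvc hinvp).sgpCap y *
          (u : Aut (ofConnectedTemperoidData h Q odd_l R ιX K' constEmb constEmb_injective hinvc hinvp).BN) *
          ((ofConnectedTemperoidData h Q odd_l R ιX K' constEmb constEmb_injective hinvc hinvp).sgpCap y)⁻¹ = u) →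
      (ofConnectedTemperoidData h Q odd_l R ιX K' constEmb constEmb_injective hinvc hinvp).unitsToBirat
          (ofConnectedTemperoidData h Q odd_l R ιX K' constEmb constEmb_injective hinvc hinvp).BN u ∈
        (ofConnectedTemperoidData h Q odd_l R ιX K' constEmb constEmb_injective hinvc hinvp).constEmb.range) :
    (ofConnectedTemperoidData h Q odd_l R ιX K' constEmb constEmb_injective hinvc hinvp).Facts :=
  facts_ofModelData_of_geomConnected h Q odd_l R ιX _ _ K' constEmb constEmb_injective _ _
    (baseMap_strvOfBiKummerData h R) hH hconst rfl hgc

include h in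
/-- **`hinvc` over `B^temp(Π^tp_X)⁰` from the `Π^tp_X`-stability `hθ` of `Div(s')`** (`(s', s'')` the fraction-pair of `Θ̈` on `A_⊙`;
§5 p.330 (PDF p.104); naturality `hS` a theorem here, `Φ` divisorial by `h`).  [cite: MochizukiEtTh2009, §5 p.330 (PDF p.104); Prop 4.3 (i) p.317 (PDF p.91)] -/
theorem hinvc_ofConnectedTemperoid
    (hθ : ∀ x : X.Pi, pull tf.divisorMonoid ((BiKummerSetting.mkOfConnectedTemperoid X tf hZ hP NH A₀ hA₀ hA₀').galoisSurj
      A₀.base hA₀' x).hom (ModelFrobenioid.div Pl.num) = ModelFrobenioid.div Pl.num) (g : Aut R.AN.base) :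
    pull tf.divisorMonoid g.hom (ModelFrobenioid.div R.pair.num) = ModelFrobenioid.div R.pair.num :=
  hinvc_of_thetaDivisor R h.isDivisorial (BiKummerSetting.mkOfConnectedTemperoid_galoisSurj_natural X tf hZ hP NH A₀ hA₀ hA₀')
    hθ g

include h in
/-- **`hinvp` over `B^temp(Π^tp_X)⁰` from the `Π^tp_X`-stability `hθ'` of `Div(s'')`** (Prop. 4.3 (i) proof, p.317 (PDF p.91)).
[cite: MochizukiEtTh2009, Prop 4.3 (i) p.317 (PDF p.91)] -/
theorem hinvp_ofConnectedTemperoid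
    (hθ' : ∀ x : X.Pi, pull tf.divisorMonoid ((BiKummerSetting.mkOfConnectedTemperoid X tf hZ hP NH A₀ hA₀ hA₀').galoisSurj
      A₀.base hA₀' x).hom (ModelFrobenioid.div Pl.den) = ModelFrobenioid.div Pl.den) (y : T.PiX) (hy : y ∈ T.PiYdd) :
    pull tf.divisorMonoid ((BiKummerSetting.mkOfConnectedTemperoid X tf hZ hP NH A₀ hA₀ hA₀').galoisSurj R.AN.base
      R.αData.isGalois (ιX y)).hom (ModelFrobenioid.div R.pair.den) = ModelFrobenioid.div R.pair.den :=
  hinvp_of_thetaDivisor R ιX h.isDivisorial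
    (BiKummerSetting.mkOfConnectedTemperoid_galoisSurj_natural X tf hZ hP NH A₀ hA₀ hA₀') hθ' y hy

end ThetaFrobenioid

end Literature.AnabelianGeometry.EtaleTheta

end
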